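import Mathlib
import HarnessLib
import Literature.Probability.Process.PointStationaryLaw
import Literature.MathematicalPhysics.StatisticalMechanics.MuGroundStateConfiguration
import Summits.AtomisticToContinuum.Crystallization.Theorems.FrustratedLawDichotomyNashStabilityCalculus

/-!
# Crux `AperiodicFrustratedLawGap` — what the NASH clause (e) gives pointwise, second order: LOCAL STABILITY

Route `FrustratedLawDichotomy` (and `PeriodicChargeSplit`), crux `AperiodicFrustratedLawGap`
(item `stmt-AtomisticToContinuum-27623`); hand-1 lane (direct consequences of the crux's own hypotheses), part B of
the second-order reading of clause (e) (part A = `FrustratedLawDichotomyNashStabilityCalculus`).  ROUTE-INDEPENDENT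
(no `Theses` import; `UniformlyDiscrete` from `MuGroundStateConfiguration`, the variant compatible with the route file).

For a rooted `δ`-hard-core configuration `μ = count|S` and an atom `p` passing the one-particle Nash test of the crux
(`Σ'_{q ≠ p} V_LJ(|p − q|) ≤ Σ'_{q ≠ p} V_LJ(|y − q|)` for every `y` off the other atoms), the one-particle field
restricted to a line `t ↦ p + t e` (`‖e‖ = 1`) is twice termwise-differentiable on `|t| < δ/2`
(`hasDerivAt_tsum_of_isPreconnected` twice, `r⁻⁶` domination from part A, shell counting) and has a local minimum at
`t = 0`, so its second derivative there is `≥ 0` (`deriv2_nonneg_of_isLocalMin`); summing over the three coordinate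
directions gives the trace of the Hessian:

* `laplacian_nonneg_of_nash` — **local (Laplacian) stability**: `Σ_{q ≠ p} (11 |p − q|⁻¹⁴ − 5 |p − q|⁻⁸) ≥ 0`, the
  series converging absolutely (`Σ_q ΔV_LJ(|p − q|) ≥ 0`, `ΔV_LJ = V″ + (2/r)V′`);
* `exists_near_of_nash` — **every atom has a near neighbour**: if `p` is not the only atom, some atom `q ≠ p` has
  `|p − q|⁶ ≤ 11/5`, i.e. `|p − q| ≤ (11/5)^{1/6} ≈ 1.1404` (each term with `|p − q|⁶ > 11/5` is negative);
* `ae_laplacian_nonneg_of_nash`, `ae_exists_near_of_nash` — law level: under clauses (a) (any `δ > 0`) and (e) of the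
  crux, `P`-almost every configuration is locally stable at every atom, and every atom of it that is not alone has
  another atom within distance `(11/5)^{1/6}`.

Compare the first-order reading (`FrustratedLawDichotomyNashForceBalance`: force balance) and hand-2's law-level
no-rattlers cut (another atom within `R` whenever `δR > 10`, for MINIMISING laws): local stability is pointwise, needs no
minimality, and its radius `(11/5)^{1/6}` is absolute.  All `[folklore]` (second-order condition for the one-particle
field; cf. Blanc–Lewin 2015 §1.2).
-/

noncomputable section

open Metric Filter Topology MeasureTheory
open scoped RealInnerProductSpace

namespace Summit.AtomisticToContinuum.Crystallization.Theorems.FrustratedLawDichotomyNashLocalStability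

open Literature.MathematicalPhysics.StatisticalMechanics (lennardJones UniformlyDiscrete)
open Literature.Probability.Process (IsRootedHardCore count_restrict_singleton_ne_zero_iff)
open Summit.AtomisticToContinuum.Crystallization.Theorems.FrustratedLawDichotomyNashStabilityCalculus

/-- **Shell counting**: over a `δ`-separated set of points all at distance `≥ δ` from `p`, `Σ |p − q|⁻⁶` converges
(partial sums `≤ 250 δ⁻⁶`, `sum_inv_pow_six_le_of_forall_le_dist`). [folklore] -/
theorem summable_inv_pow_six_of_sep {S Y : Set (EuclideanSpace ℝ (Fin 3))} {δ : ℝ} (hδ : 0 < δ)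
    (hsep : ∀ x ∈ S, ∀ y ∈ S, x ≠ y → δ ≤ dist x y) (hYS : Y ⊆ S) {p : EuclideanSpace ℝ (Fin 3)}
    (hfar : ∀ q ∈ Y, δ ≤ dist p q) :
    Summable fun q : Y => (dist p (q : EuclideanSpace ℝ (Fin 3)))⁻¹ ^ 6 := by
  classical
  refine summable_of_sum_le (c := 250 * δ⁻¹ ^ 6) (fun q => by positivity) fun u => ?_
  have h := Literature.MathematicalPhysics.StatisticalMechanics.sum_inv_pow_six_le_of_forall_le_dist
    (u.image Subtype.val) p hδ
    (fun y hy => by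
      obtain ⟨q, -, rfl⟩ := Finset.mem_image.1 hy
      exact hfar q q.2)
    (fun y hy y' hy' hne => by
      obtain ⟨q, -, rfl⟩ := Finset.mem_image.1 hy
      obtain ⟨q', -, rfl⟩ := Finset.mem_image.1 hy'
      exact hsep _ (hYS q.2) _ (hYS q'.2) hne)
  rwa [Finset.sum_image fun a _ b _ h => Subtype.val_injective h] at h

/-- **Second-order Nash condition along one line.**  Let `μ = count|S` be a rooted `δ`-hard-core configuration
(`δ > 0`), `p` an atom passing the one-particle Nash test of the crux, and `e` a unit vector.  Then the family of
second derivatives at `t = 0` of the terms `t ↦ V_LJ(|p + t e − q|)`, `q ≠ p` an atom, is summable with nonnegative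
sum: `Σ_{q ≠ p} [G″(r_q²)(2⟨p − q, e⟩)² + G′(r_q²)·2] ≥ 0`. [folklore] -/
theorem line_second_order_of_nash {δ : ℝ} (hδ : 0 < δ) {μ : Measure (EuclideanSpace ℝ (Fin 3))}
    (hμ : IsRootedHardCore δ μ) {p : EuclideanSpace ℝ (Fin 3)} (hp : μ {p} ≠ 0)
    (hNash : ∀ y : EuclideanSpace ℝ (Fin 3), (∀ q : EuclideanSpace ℝ (Fin 3), μ {q} ≠ 0 → q ≠ p → y ≠ q) →
      ∑' q : {q : EuclideanSpace ℝ (Fin 3) // μ {q} ≠ 0 ∧ q ≠ p}, lennardJones (dist p (q : EuclideanSpace ℝ (Fin 3))) ≤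
        ∑' q : {q : EuclideanSpace ℝ (Fin 3) // μ {q} ≠ 0 ∧ q ≠ p}, lennardJones (dist y (q : EuclideanSpace ℝ (Fin 3))))
    {e : EuclideanSpace ℝ (Fin 3)} (he : ‖e‖ = 1) :
    Summable (fun q : {q : EuclideanSpace ℝ (Fin 3) // μ {q} ≠ 0 ∧ q ≠ p} =>
        ((7 / 2 : ℝ) * (‖p - q‖ ^ 2)⁻¹ ^ 8 - 2 * (‖p - q‖ ^ 2)⁻¹ ^ 5) * (2 * ⟪p - q, e⟫) * (2 * ⟪p - q, e⟫) +
          (-(1 / 2 : ℝ) * (‖p - q‖ ^ 2)⁻¹ ^ 7 + (1 / 2 : ℝ) * (‖p - q‖ ^ 2)⁻¹ ^ 4) * (2 * ‖e‖ ^ 2)) ∧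
      0 ≤ ∑' q : {q : EuclideanSpace ℝ (Fin 3) // μ {q} ≠ 0 ∧ q ≠ p},
        (((7 / 2 : ℝ) * (‖p - q‖ ^ 2)⁻¹ ^ 8 - 2 * (‖p - q‖ ^ 2)⁻¹ ^ 5) * (2 * ⟪p - q, e⟫) * (2 * ⟪p - q, e⟫) +
          (-(1 / 2 : ℝ) * (‖p - q‖ ^ 2)⁻¹ ^ 7 + (1 / 2 : ℝ) * (‖p - q‖ ^ 2)⁻¹ ^ 4) * (2 * ‖e‖ ^ 2)) := by
  obtain ⟨S, -, hsep, rfl⟩ := hμ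
  have hmem : ∀ q : EuclideanSpace ℝ (Fin 3),
      (Measure.count : Measure (EuclideanSpace ℝ (Fin 3))).restrict S {q} ≠ 0 ↔ q ∈ S :=
    count_restrict_singleton_ne_zero_iff S
  have hpS : p ∈ S := (hmem p).1 hp
  set Y : Set (EuclideanSpace ℝ (Fin 3)) :=
    {q | (Measure.count : Measure (EuclideanSpace ℝ (Fin 3))).restrict S {q} ≠ 0 ∧ q ≠ p} with hY
  have hYS : Y ⊆ S := fun q hq => (hmem q).1 hq.1
  have hYud : UniformlyDiscrete Y := ⟨δ, hδ, fun x hx y hy hxy => hsep x (hYS hx) y (hYS hy) hxy⟩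
  have hfar : ∀ q : Y, δ ≤ dist p q := fun q => hsep p hpS q (hYS q.2) fun h => q.2.2 (h ▸ rfl)
  -- the interval `|t| < δ/2` and the geometry of `x = p + t e − q`
  set U : Set ℝ := ball (0 : ℝ) (δ / 2) with hU
  have h0U : (0 : ℝ) ∈ U := mem_ball_self (by positivity)
  have hgeom : ∀ t ∈ U, ∀ q : Y,
      dist p q / 2 ≤ ‖p + t • e - q‖ ∧ δ / 2 ≤ ‖p + t • e - q‖ := by
    intro t ht q
    have ht' : |t| < δ / 2 := by
      have ht2 := ht
      rw [hU, mem_ball, Real.dist_eq, sub_zero] at ht2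
      exact ht2
    have hte : ‖t • e‖ = |t| := by rw [norm_smul, Real.norm_eq_abs, he, mul_one]
    have h1 : ‖p - q‖ ≤ ‖p + t • e - q‖ + ‖t • e‖ := by
      have := norm_sub_le (p + t • e - q) (t • e)
      rwa [show p + t • e - (q : EuclideanSpace ℝ (Fin 3)) - t • e = p - q by abel] at this
    rw [hte] at h1
    have h2 := hfar q
    rw [dist_eq_norm] at h2 ⊢
    constructor <;> linarith
  have hne : ∀ t ∈ U, ∀ q : Y, p + t • e ≠ (q : EuclideanSpace ℝ (Fin 3)) := by
    intro t ht q h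
    have := (hgeom t ht q).2
    rw [h, sub_self, norm_zero] at this
    linarith
  -- the terms and their first two derivatives along the line
  set f : Y → ℝ → ℝ := fun q t => lennardJones (dist (p + t • e) q) with hf
  set f1 : Y → ℝ → ℝ := fun q t =>
    (-(1 / 2 : ℝ) * (‖p + t • e - q‖ ^ 2)⁻¹ ^ 7 + (1 / 2 : ℝ) * (‖p + t • e - q‖ ^ 2)⁻¹ ^ 4) *
      (2 * ⟪p - q, e⟫ + 2 * ‖e‖ ^ 2 * t) with hf1
  set f2 : Y → ℝ → ℝ := fun q t =>
    ((7 / 2 : ℝ) * (‖p + t • e - q‖ ^ 2)⁻¹ ^ 8 - 2 * (‖p + t • e - q‖ ^ 2)⁻¹ ^ 5) *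
        (2 * ⟪p - q, e⟫ + 2 * ‖e‖ ^ 2 * t) * (2 * ⟪p - q, e⟫ + 2 * ‖e‖ ^ 2 * t) +
      (-(1 / 2 : ℝ) * (‖p + t • e - q‖ ^ 2)⁻¹ ^ 7 + (1 / 2 : ℝ) * (‖p + t • e - q‖ ^ 2)⁻¹ ^ 4) *
        (2 * ‖e‖ ^ 2) with hf2
  have hderiv1 : ∀ (q : Y) (t : ℝ), t ∈ U → HasDerivAt (f q) (f1 q t) t := fun q t ht =>
    hasDerivAt_lennardJones_line (hne t ht q)
  have hderiv2 : ∀ (q : Y) (t : ℝ), t ∈ U → HasDerivAt (f1 q) (f2 q t) t := fun q t ht =>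
    hasDerivAt_lennardJones_line_deriv (hne t ht q)
  -- `r⁻⁶` domination
  set C1 : ℝ := (δ / 2)⁻¹ ^ 7 + (δ / 2)⁻¹ with hC1
  set C2 : ℝ := 15 * (δ / 2)⁻¹ ^ 8 + 9 * (δ / 2)⁻¹ ^ 2 with hC2
  have hC1pos : 0 ≤ C1 := by positivity
  have hC2pos : 0 ≤ C2 := by positivity
  have hinv6 : ∀ t ∈ U, ∀ q : Y, ‖p + t • e - q‖⁻¹ ^ 6 ≤ 2 ^ 6 * (dist p q)⁻¹ ^ 6 := by
    intro t ht q
    obtain ⟨hhalf, hρ⟩ := hgeom t ht q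
    have hx0 : 0 < ‖p + t • e - q‖ := by linarith
    have hpq0 : 0 < dist p q := by linarith [hfar q]
    have : ‖p + t • e - q‖⁻¹ ≤ 2 * (dist p q)⁻¹ := by
      rw [← inv_inv (2 : ℝ), ← mul_inv, inv_le_inv₀ hx0 (by positivity)]
      linarith
    calc ‖p + t • e - q‖⁻¹ ^ 6 ≤ (2 * (dist p q)⁻¹) ^ 6 := pow_le_pow_left₀ (inv_nonneg.2 hx0.le) this 6
      _ = 2 ^ 6 * (dist p q)⁻¹ ^ 6 := by ring
  set u1 : Y → ℝ := fun q => C1 * (2 ^ 6 * (dist p q)⁻¹ ^ 6) with hu1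
  set u2 : Y → ℝ := fun q => C2 * (2 ^ 6 * (dist p q)⁻¹ ^ 6) with hu2
  have h6 : Summable fun q : Y => (dist p (q : EuclideanSpace ℝ (Fin 3)))⁻¹ ^ 6 :=
    summable_inv_pow_six_of_sep hδ hsep hYS fun q hq => hfar ⟨q, hq⟩
  have hu1s : Summable u1 := (h6.mul_left (2 ^ 6)).mul_left C1
  have hu2s : Summable u2 := (h6.mul_left (2 ^ 6)).mul_left C2
  have hbound1 : ∀ (q : Y) (t : ℝ), t ∈ U → ‖f1 q t‖ ≤ u1 q := by
    intro q t ht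
    rw [Real.norm_eq_abs]
    simp only [hf1]
    rw [two_inner_line p q e t]
    exact (abs_deriv_term_le (by positivity : (0 : ℝ) < δ / 2) he (hgeom t ht q).2).trans
      (mul_le_mul_of_nonneg_left (hinv6 t ht q) hC1pos)
  have hbound2 : ∀ (q : Y) (t : ℝ), t ∈ U → ‖f2 q t‖ ≤ u2 q := by
    intro q t ht
    rw [Real.norm_eq_abs]
    simp only [hf2]
    rw [two_inner_line p q e t]
    exact (abs_deriv2_term_le (by positivity : (0 : ℝ) < δ / 2) he (hgeom t ht q).2).trans
      (mul_le_mul_of_nonneg_left (hinv6 t ht q) hC2pos)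
  -- summability at `t = 0`
  have hf0 : Summable fun q : Y => f q 0 := by
    simp only [hf, zero_smul, add_zero]
    exact hYud.summable_lennardJones_dist p
  have hf1s : Summable fun q : Y => f1 q 0 := Summable.of_norm_bounded hu1s fun q => hbound1 q 0 h0U
  have hf2s : Summable fun q : Y => f2 q 0 := Summable.of_norm_bounded hu2s fun q => hbound2 q 0 h0U
  -- termwise differentiation, twice
  have hF : ∀ t ∈ U, HasDerivAt (fun t => ∑' q : Y, f q t) (∑' q : Y, f1 q t) t := fun t ht =>
    hasDerivAt_tsum_of_isPreconnected hu1s isOpen_ball (convex_ball (0 : ℝ) (δ / 2)).isPreconnected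
      hderiv1 hbound1 h0U hf0 ht
  have hF1 : HasDerivAt (fun t => ∑' q : Y, f1 q t) (∑' q : Y, f2 q 0) 0 :=
    hasDerivAt_tsum_of_isPreconnected hu2s isOpen_ball (convex_ball (0 : ℝ) (δ / 2)).isPreconnected
      hderiv2 hbound2 h0U hf1s h0U
  -- the Nash test along the line: local minimum at `t = 0`
  have hmin : IsLocalMin (fun t => ∑' q : Y, f q t) 0 := by
    refine Filter.eventually_of_mem (isOpen_ball.mem_nhds h0U) fun t ht => ?_
    show ∑' q : Y, f q 0 ≤ ∑' q : Y, f q t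
    simp only [hf, zero_smul, add_zero]
    exact hNash (p + t • e) fun q hq hqp => hne t ht ⟨q, hq, hqp⟩
  have hev : ∀ᶠ t in 𝓝 (0 : ℝ), HasDerivAt (fun t => ∑' q : Y, f q t) (∑' q : Y, f1 q t) t :=
    Filter.eventually_of_mem (isOpen_ball.mem_nhds h0U) hF
  have h2nd : 0 ≤ ∑' q : Y, f2 q 0 := deriv2_nonneg_of_isLocalMin hmin hev hF1
  -- read off at `t = 0`
  have hf2_0 : ∀ q : Y, f2 q 0 =
      ((7 / 2 : ℝ) * (‖p - q‖ ^ 2)⁻¹ ^ 8 - 2 * (‖p - q‖ ^ 2)⁻¹ ^ 5) * (2 * ⟪p - q, e⟫) * (2 * ⟪p - q, e⟫) +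
        (-(1 / 2 : ℝ) * (‖p - q‖ ^ 2)⁻¹ ^ 7 + (1 / 2 : ℝ) * (‖p - q‖ ^ 2)⁻¹ ^ 4) * (2 * ‖e‖ ^ 2) := by
    intro q
    simp only [hf2, zero_smul, add_zero, mul_zero]
  refine ⟨hf2s.congr hf2_0, ?_⟩
  calc (0 : ℝ) ≤ ∑' q : Y, f2 q 0 := h2nd
    _ = _ := tsum_congr hf2_0

/-- **Local (Laplacian) stability from the Nash clause (pointwise, deterministic).**  Let `μ = count|S` be a rooted
`δ`-hard-core configuration (`δ > 0`) and `p` an atom passing the one-particle Nash test of the crux (clause (e) at `p`,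
verbatim).  Then `Σ_{q ≠ p} (11 |p − q|⁻¹⁴ − 5 |p − q|⁻⁸)` converges absolutely to a NONNEGATIVE sum: the trace of the
Hessian of the one-particle field at its local minimum `p` (`ΔV_LJ(|x|) = 11|x|⁻¹⁴ − 5|x|⁻⁸`). [folklore] -/
theorem laplacian_nonneg_of_nash {δ : ℝ} (hδ : 0 < δ) {μ : Measure (EuclideanSpace ℝ (Fin 3))}
    (hμ : IsRootedHardCore δ μ) {p : EuclideanSpace ℝ (Fin 3)} (hp : μ {p} ≠ 0)
    (hNash : ∀ y : EuclideanSpace ℝ (Fin 3), (∀ q : EuclideanSpace ℝ (Fin 3), μ {q} ≠ 0 → q ≠ p → y ≠ q) →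
      ∑' q : {q : EuclideanSpace ℝ (Fin 3) // μ {q} ≠ 0 ∧ q ≠ p}, lennardJones (dist p (q : EuclideanSpace ℝ (Fin 3))) ≤
        ∑' q : {q : EuclideanSpace ℝ (Fin 3) // μ {q} ≠ 0 ∧ q ≠ p}, lennardJones (dist y (q : EuclideanSpace ℝ (Fin 3)))) :
    ∃ L : ℝ, 0 ≤ L ∧ HasSum (fun q : {q : EuclideanSpace ℝ (Fin 3) // μ {q} ≠ 0 ∧ q ≠ p} =>
      11 * (dist p (q : EuclideanSpace ℝ (Fin 3)))⁻¹ ^ 14 - 5 * (dist p (q : EuclideanSpace ℝ (Fin 3)))⁻¹ ^ 8) L := by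
  have hone : ∀ i : Fin 3, ‖EuclideanSpace.single i (1 : ℝ)‖ = 1 := fun i => by simp
  have hline := fun i : Fin 3 => line_second_order_of_nash hδ hμ hp hNash (hone i)
  refine ⟨∑ i : Fin 3, ∑' q : {q : EuclideanSpace ℝ (Fin 3) // μ {q} ≠ 0 ∧ q ≠ p},
      (((7 / 2 : ℝ) * (‖p - q‖ ^ 2)⁻¹ ^ 8 - 2 * (‖p - q‖ ^ 2)⁻¹ ^ 5) *
          (2 * ⟪p - q, EuclideanSpace.single i (1 : ℝ)⟫) * (2 * ⟪p - q, EuclideanSpace.single i (1 : ℝ)⟫) +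
        (-(1 / 2 : ℝ) * (‖p - q‖ ^ 2)⁻¹ ^ 7 + (1 / 2 : ℝ) * (‖p - q‖ ^ 2)⁻¹ ^ 4) *
          (2 * ‖EuclideanSpace.single i (1 : ℝ)‖ ^ 2)),
    Finset.sum_nonneg fun i _ => (hline i).2, ?_⟩
  have hsum := hasSum_sum (s := (Finset.univ : Finset (Fin 3))) fun i _ => ((hline i).1).hasSum
  refine hsum.congr_fun fun q => ?_
  have hpq : p - (q : EuclideanSpace ℝ (Fin 3)) ≠ 0 := sub_ne_zero.2 (Ne.symm q.2.2)
  rw [dist_eq_norm]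
  exact (laplacian_lennardJones_term hpq).symm

/-- **Every atom passing the Nash test has a neighbour within `(11/5)^{1/6} ≈ 1.1404`** (unless it is the only atom):
if all other atoms had `|p − q|⁶ > 11/5`, every term `11|p − q|⁻¹⁴ − 5|p − q|⁻⁸` of the nonnegative Laplacian sum
would be negative. [folklore] -/
theorem exists_near_of_nash {δ : ℝ} (hδ : 0 < δ) {μ : Measure (EuclideanSpace ℝ (Fin 3))}
    (hμ : IsRootedHardCore δ μ) {p : EuclideanSpace ℝ (Fin 3)} (hp : μ {p} ≠ 0)
    (hNash : ∀ y : EuclideanSpace ℝ (Fin 3), (∀ q : EuclideanSpace ℝ (Fin 3), μ {q} ≠ 0 → q ≠ p → y ≠ q) →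
      ∑' q : {q : EuclideanSpace ℝ (Fin 3) // μ {q} ≠ 0 ∧ q ≠ p}, lennardJones (dist p (q : EuclideanSpace ℝ (Fin 3))) ≤
        ∑' q : {q : EuclideanSpace ℝ (Fin 3) // μ {q} ≠ 0 ∧ q ≠ p}, lennardJones (dist y (q : EuclideanSpace ℝ (Fin 3))))
    (hother : ∃ q : EuclideanSpace ℝ (Fin 3), μ {q} ≠ 0 ∧ q ≠ p) :
    ∃ q : EuclideanSpace ℝ (Fin 3), μ {q} ≠ 0 ∧ q ≠ p ∧ dist p q ^ 6 ≤ 11 / 5 := by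
  obtain ⟨L, hL, hsum⟩ := laplacian_nonneg_of_nash hδ hμ hp hNash
  by_contra hcon
  push Not at hcon
  obtain ⟨q₀, hq₀, hq₀p⟩ := hother
  have hsepδ : ∀ q : {q : EuclideanSpace ℝ (Fin 3) // μ {q} ≠ 0 ∧ q ≠ p}, 0 < dist p q := by
    intro q
    obtain ⟨S, -, hsep, rfl⟩ := hμ
    have hq : (q : EuclideanSpace ℝ (Fin 3)) ∈ S := (count_restrict_singleton_ne_zero_iff S q).1 q.2.1
    have hpS : p ∈ S := (count_restrict_singleton_ne_zero_iff S p).1 hp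
    exact hδ.trans_le (hsep p hpS q hq fun h => q.2.2 (h ▸ rfl))
  have hneg : ∀ q : {q : EuclideanSpace ℝ (Fin 3) // μ {q} ≠ 0 ∧ q ≠ p},
      11 * (dist p (q : EuclideanSpace ℝ (Fin 3)))⁻¹ ^ 14 - 5 * (dist p (q : EuclideanSpace ℝ (Fin 3)))⁻¹ ^ 8 < 0 := by
    intro q
    have hr := hsepδ q
    have h6 : 11 / 5 < dist p (q : EuclideanSpace ℝ (Fin 3)) ^ 6 := hcon q q.2.1 q.2.2
    have hinv6 : (dist p (q : EuclideanSpace ℝ (Fin 3)))⁻¹ ^ 6 < 5 / 11 := by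
      rw [inv_pow]
      have h0 : (0 : ℝ) < 11 / 5 := by norm_num
      calc (dist p (q : EuclideanSpace ℝ (Fin 3)) ^ 6)⁻¹ < (11 / 5 : ℝ)⁻¹ := (inv_lt_inv₀ (h0.trans h6) h0).2 h6
        _ = 5 / 11 := by norm_num
    have h8 : 0 < (dist p (q : EuclideanSpace ℝ (Fin 3)))⁻¹ ^ 8 := by positivity
    have : 11 * (dist p (q : EuclideanSpace ℝ (Fin 3)))⁻¹ ^ 14 - 5 * (dist p (q : EuclideanSpace ℝ (Fin 3)))⁻¹ ^ 8 =
        (dist p (q : EuclideanSpace ℝ (Fin 3)))⁻¹ ^ 8 * (11 * (dist p (q : EuclideanSpace ℝ (Fin 3)))⁻¹ ^ 6 - 5) := by ring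
    rw [this]
    exact mul_neg_of_pos_of_neg h8 (by linarith)
  have hlt : L < 0 := by
    have h0 : HasSum (fun _ : {q : EuclideanSpace ℝ (Fin 3) // μ {q} ≠ 0 ∧ q ≠ p} => (0 : ℝ)) 0 := hasSum_zero
    have := hasSum_lt (f := fun q : {q : EuclideanSpace ℝ (Fin 3) // μ {q} ≠ 0 ∧ q ≠ p} =>
        11 * (dist p (q : EuclideanSpace ℝ (Fin 3)))⁻¹ ^ 14 - 5 * (dist p (q : EuclideanSpace ℝ (Fin 3)))⁻¹ ^ 8)
      (g := fun _ => (0 : ℝ)) (i := ⟨q₀, hq₀, hq₀p⟩) (fun q => (hneg q).le) (hneg _) hsum h0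
    simpa using this
  exact absurd hL (not_le.2 hlt)

/-- **Clauses (a) + (e) of the crux ⟹ almost-sure local stability at every atom.**  Under a.s. `δ`-hard-core (`δ > 0`)
and a.s. Nash (clause (e) verbatim), `P`-almost every configuration satisfies
`Σ_{q ≠ p} (11 |p − q|⁻¹⁴ − 5 |p − q|⁻⁸) ≥ 0` at every atom `p`. [folklore] -/
theorem ae_laplacian_nonneg_of_nash {δ : ℝ} (hδ : 0 < δ) {P : Measure (Measure (EuclideanSpace ℝ (Fin 3)))}
    (ha : ∀ᵐ μ ∂P, IsRootedHardCore δ μ)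
    (he : ∀ᵐ μ ∂P, ∀ p : EuclideanSpace ℝ (Fin 3), μ {p} ≠ 0 → ∀ y : EuclideanSpace ℝ (Fin 3),
      (∀ q : EuclideanSpace ℝ (Fin 3), μ {q} ≠ 0 → q ≠ p → y ≠ q) →
      ∑' q : {q : EuclideanSpace ℝ (Fin 3) // μ {q} ≠ 0 ∧ q ≠ p},
          lennardJones (dist p (q : EuclideanSpace ℝ (Fin 3))) ≤
        ∑' q : {q : EuclideanSpace ℝ (Fin 3) // μ {q} ≠ 0 ∧ q ≠ p},
          lennardJones (dist y (q : EuclideanSpace ℝ (Fin 3)))) :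
    ∀ᵐ μ ∂P, ∀ p : EuclideanSpace ℝ (Fin 3), μ {p} ≠ 0 →
      ∃ L : ℝ, 0 ≤ L ∧ HasSum (fun q : {q : EuclideanSpace ℝ (Fin 3) // μ {q} ≠ 0 ∧ q ≠ p} =>
        11 * (dist p (q : EuclideanSpace ℝ (Fin 3)))⁻¹ ^ 14 - 5 * (dist p (q : EuclideanSpace ℝ (Fin 3)))⁻¹ ^ 8) L := by
  filter_upwards [ha, he] with μ hμ hNash p hp using laplacian_nonneg_of_nash hδ hμ hp (hNash p hp)

/-- **Clauses (a) + (e) of the crux ⟹ almost surely every atom that is not alone has another atom within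
`(11/5)^{1/6} ≈ 1.1404`** (`|p − q|⁶ ≤ 11/5`), whatever the nominal hard core `δ > 0`. [folklore] -/
theorem ae_exists_near_of_nash {δ : ℝ} (hδ : 0 < δ) {P : Measure (Measure (EuclideanSpace ℝ (Fin 3)))}
    (ha : ∀ᵐ μ ∂P, IsRootedHardCore δ μ)
    (he : ∀ᵐ μ ∂P, ∀ p : EuclideanSpace ℝ (Fin 3), μ {p} ≠ 0 → ∀ y : EuclideanSpace ℝ (Fin 3),
      (∀ q : EuclideanSpace ℝ (Fin 3), μ {q} ≠ 0 → q ≠ p → y ≠ q) →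
      ∑' q : {q : EuclideanSpace ℝ (Fin 3) // μ {q} ≠ 0 ∧ q ≠ p},
          lennardJones (dist p (q : EuclideanSpace ℝ (Fin 3))) ≤
        ∑' q : {q : EuclideanSpace ℝ (Fin 3) // μ {q} ≠ 0 ∧ q ≠ p},
          lennardJones (dist y (q : EuclideanSpace ℝ (Fin 3)))) :
    ∀ᵐ μ ∂P, ∀ p : EuclideanSpace ℝ (Fin 3), μ {p} ≠ 0 →
      (∃ q : EuclideanSpace ℝ (Fin 3), μ {q} ≠ 0 ∧ q ≠ p) →
      ∃ q : EuclideanSpace ℝ (Fin 3), μ {q} ≠ 0 ∧ q ≠ p ∧ dist p q ^ 6 ≤ 11 / 5 := by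
  filter_upwards [ha, he] with μ hμ hNash p hp hother using exists_near_of_nash hδ hμ hp (hNash p hp) hother

end Summit.AtomisticToContinuum.Crystallization.Theorems.FrustratedLawDichotomyNashLocalStability

end
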